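import Summits.CriticalPhenomena.CardyFormulaZ2.Theorems.CardySusyWardWeakHolomorphyWeakKirchhoff
import Summits.CriticalPhenomena.CardyFormulaZ2.Theorems.CardySusyWardWeakHolomorphySpinShift

/-!
# The crux `CardySusyWard.WeakHolomorphy` IS the weak vanishing of the spin-`−5/3` alias of the dart observable

Line `Sketch` of the crux `CardySusyWard.WeakHolomorphy` (stmt-CriticalPhenomena-11292), lead c3 (infrastructure,
`--supports`).  Composition of the two landed characterisations: `weakHolomorphy_iff_weakKirchhoff` (the crux is the
`∂φ`-tested weak law of the staggered Kirchhoff defect `K^s_p` of the spin-`1/3` dart observable) and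
`staggeredKirchhoff_eq_spinShift` (`K^s_p = ±Σ_k F^{(−5/3)}(c_{p,k})`, one sign per datum).  Result
(`weakHolomorphy_iff_spinShiftVanishes`): `WeakHolomorphy` holds iff along every admissible family and for every smooth
test function `φ` compactly supported in the domain,
  `δ^{5/3} · Σ_p ∂φ(z_p) · Σ_{k} F^{(−5/3)}_δ(c_{p,k}) → 0`,   `F^{(−5/3)}_δ = bondDartObservable (Λ δ) δ (−5/3)`:
the vertex-summed spin-`−5/3` dart observable — the ALIAS of the spin-`1/3` one on the square lattice — vanishes weakly at
the spin-`1/3` scale `δ^{-5/3}`.  (Coulomb-gas heuristic, `Cruxes/WeakHolomorphy/Disproof.lean` §D/§F: two-arm dimension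
`x(s) = 1/4 + 3s²/4`, `x(−5/3) = 7/3 > 2`, so the alias should be `O(δ^{7/3})` per vertex against the allowed `o(δ^{1/3})`;
no rigorous bound beyond `O(δ^{a₀})` is known on `ℤ²`.)
References: Duminil-Copin–Smirnov arXiv:1109.1549 §8.3, Conj. 8.7.
-/

noncomputable section

namespace Summit.CriticalPhenomena.CardyFormulaZ2.Theorems.WeakHolomorphy.SplitBypass

open scoped BigOperators Topology
open Filter Set MeasureTheory Complex
open _root_.Literature.Probability.LatticeModels
open _root_.Literature.Probability.RandomPlanarGeometry (DobrushinDomain)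
open _root_.Literature.Barriers.CriticalPhenomena (medialCornersAt medialVertexOf)
open Summit.CriticalPhenomena.CardyFormulaZ2.Theorems.ParafermionPrecompact.Negative (IsFamily)

/-- **Weak Kirchhoff ⟺ weak vanishing of the spin-`−5/3` alias, per family and test function**: along an admissible family,
eventually the two finsums differ by a unimodular factor (`staggeredKirchhoff_eq_spinShift`), so their norms agree.
[cite: DuminilCopinSmirnov2012Lattice, §8.3] -/
theorem weakKirchhoff_tendsto_iff_spinShift (D : DobrushinDomain) (Λ : ℝ → DiscreteDobrushin) (hΛ : IsFamily D Λ)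
    (φ : ℂ → ℂ) :
    Tendsto (fun δ : ℝ => ((δ ^ ((5:ℝ) / 3) : ℝ) : ℂ) * ∑ᶠ p : Site 2 × Fin 2,
        (fderiv ℝ φ (medialPoint δ (medialVertexOf p)) 1 -
            Complex.I * fderiv ℝ φ (medialPoint δ (medialVertexOf p)) Complex.I) / 2 *
          (bondDartObservable (Λ δ) δ (1 / 3) (medialCornersAt p.1 p.2 1) +
            bondDartObservable (Λ δ) δ (1 / 3) (medialCornersAt p.1 p.2 3) -
            bondDartObservable (Λ δ) δ (1 / 3) (medialCornersAt p.1 p.2 0) -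
            bondDartObservable (Λ δ) δ (1 / 3) (medialCornersAt p.1 p.2 2)))
      (𝓝[>] 0) (𝓝 0) ↔
    Tendsto (fun δ : ℝ => ((δ ^ ((5:ℝ) / 3) : ℝ) : ℂ) * ∑ᶠ p : Site 2 × Fin 2,
        (fderiv ℝ φ (medialPoint δ (medialVertexOf p)) 1 -
            Complex.I * fderiv ℝ φ (medialPoint δ (medialVertexOf p)) Complex.I) / 2 *
          ∑ k : Fin 4, bondDartObservable (Λ δ) δ (-5 / 3) (medialCornersAt p.1 p.2 k))
      (𝓝[>] 0) (𝓝 0) := by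
  have hadm := hΛ.2.2.2.2.2
  have hnorm : ∀ᶠ δ in 𝓝[>] (0:ℝ),
      ‖((δ ^ ((5:ℝ) / 3) : ℝ) : ℂ) * ∑ᶠ p : Site 2 × Fin 2,
        (fderiv ℝ φ (medialPoint δ (medialVertexOf p)) 1 -
            Complex.I * fderiv ℝ φ (medialPoint δ (medialVertexOf p)) Complex.I) / 2 *
          (bondDartObservable (Λ δ) δ (1 / 3) (medialCornersAt p.1 p.2 1) +
            bondDartObservable (Λ δ) δ (1 / 3) (medialCornersAt p.1 p.2 3) -
            bondDartObservable (Λ δ) δ (1 / 3) (medialCornersAt p.1 p.2 0) -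
            bondDartObservable (Λ δ) δ (1 / 3) (medialCornersAt p.1 p.2 2))‖ =
      ‖((δ ^ ((5:ℝ) / 3) : ℝ) : ℂ) * ∑ᶠ p : Site 2 × Fin 2,
        (fderiv ℝ φ (medialPoint δ (medialVertexOf p)) 1 -
            Complex.I * fderiv ℝ φ (medialPoint δ (medialVertexOf p)) Complex.I) / 2 *
          ∑ k : Fin 4, bondDartObservable (Λ δ) δ (-5 / 3) (medialCornersAt p.1 p.2 k)‖ := by
    filter_upwards [hadm, self_mem_nhdsWithin] with δ hA hδpos
    have hδ : δ ≠ 0 := ne_of_gt hδpos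
    obtain ⟨ε, hε, hid⟩ := stub_staggeredKirchhoffEqSpinShift (Λ δ) hA
    have hfun : (fun p : Site 2 × Fin 2 => (fderiv ℝ φ (medialPoint δ (medialVertexOf p)) 1 -
            Complex.I * fderiv ℝ φ (medialPoint δ (medialVertexOf p)) Complex.I) / 2 *
          (bondDartObservable (Λ δ) δ (1 / 3) (medialCornersAt p.1 p.2 1) +
            bondDartObservable (Λ δ) δ (1 / 3) (medialCornersAt p.1 p.2 3) -
            bondDartObservable (Λ δ) δ (1 / 3) (medialCornersAt p.1 p.2 0) -
            bondDartObservable (Λ δ) δ (1 / 3) (medialCornersAt p.1 p.2 2))) =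
        fun p : Site 2 × Fin 2 => ε * ((fderiv ℝ φ (medialPoint δ (medialVertexOf p)) 1 -
            Complex.I * fderiv ℝ φ (medialPoint δ (medialVertexOf p)) Complex.I) / 2 *
          ∑ k : Fin 4, bondDartObservable (Λ δ) δ (-5 / 3) (medialCornersAt p.1 p.2 k)) := by
      funext p; rw [hid p δ hδ]; ring
    rw [hfun]
    rcases hε with rfl | rfl
    · simp only [one_mul]
    · simp only [neg_one_mul, finsum_neg_distrib, mul_neg, norm_neg]
  constructor
  · intro h
    have h1 := tendsto_zero_iff_norm_tendsto_zero.1 h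
    exact tendsto_zero_iff_norm_tendsto_zero.2 (h1.congr' hnorm)
  · intro h
    have h1 := tendsto_zero_iff_norm_tendsto_zero.1 h
    exact tendsto_zero_iff_norm_tendsto_zero.2 (h1.congr' (hnorm.mono fun δ hδ => hδ.symm))

/-- **The crux IS the weak vanishing of the spin-`−5/3` alias.** `WeakHolomorphy` holds iff along every admissible family
of every Dobrushin domain and for every smooth test function compactly supported in the domain,
`δ^{5/3} Σ_p ∂φ(z_p) Σ_k F^{(−5/3)}_δ(c_{p,k}) → 0` as `δ → 0⁺` (`F^{(−5/3)}_δ = bondDartObservable (Λ δ) δ (−5/3)`, the sum over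
the four corners of the medial vertex `p`). [cite: DuminilCopinSmirnov2012Lattice, Conjecture 8.7] -/
theorem weakHolomorphy_iff_spinShiftVanishes :
    Summit.CriticalPhenomena.CardyFormulaZ2.Theses.CardySusyWard.WeakHolomorphy ↔
    ∀ (D : DobrushinDomain) (Λ : ℝ → DiscreteDobrushin), IsFamily D Λ → ∀ (φ : ℂ → ℂ),
      ContDiff ℝ (⊤ : ℕ∞) φ → HasCompactSupport φ → tsupport φ ⊆ D.carrier →
        Tendsto (fun δ : ℝ => ((δ ^ ((5:ℝ) / 3) : ℝ) : ℂ) * ∑ᶠ p : Site 2 × Fin 2,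
            (fderiv ℝ φ (medialPoint δ (medialVertexOf p)) 1 -
                Complex.I * fderiv ℝ φ (medialPoint δ (medialVertexOf p)) Complex.I) / 2 *
              ∑ k : Fin 4, bondDartObservable (Λ δ) δ (-5 / 3) (medialCornersAt p.1 p.2 k))
          (𝓝[>] 0) (𝓝 0) := by
  rw [weakHolomorphy_iff_weakKirchhoff]
  constructor
  · intro h D Λ hΛ φ hφ hc hs
    exact (weakKirchhoff_tendsto_iff_spinShift D Λ hΛ φ).1 (h D Λ hΛ φ hφ hc hs)
  · intro h D Λ hΛ φ hφ hc hs
    exact (weakKirchhoff_tendsto_iff_spinShift D Λ hΛ φ).2 (h D Λ hΛ φ hφ hc hs)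

/-- **Registered one-line form of `weakHolomorphy_iff_spinShiftVanishes`**: the crux is EQUIVALENT to the weak vanishing,
at the spin-`1/3` scale `δ^{-5/3}`, of the `∂φ`-tested vertex sums of the spin-`−5/3` dart observable (the square-lattice
alias of the spin-`1/3` one). [cite: DuminilCopinSmirnov2012Lattice, Conjecture 8.7] -/
theorem stub_weakHolomorphyIffSpinShiftVanishes : Summit.CriticalPhenomena.CardyFormulaZ2.Theses.CardySusyWard.WeakHolomorphy ↔ ∀ (D : DobrushinDomain) (Λ : ℝ → DiscreteDobrushin), IsFamily D Λ → ∀ (φ : ℂ → ℂ), ContDiff ℝ (⊤ : ℕ∞) φ → HasCompactSupport φ → tsupport φ ⊆ D.carrier → Tendsto (fun δ : ℝ => ((δ ^ ((5:ℝ) / 3) : ℝ) : ℂ) * ∑ᶠ p : Site 2 × Fin 2, (fderiv ℝ φ (medialPoint δ (medialVertexOf p)) 1 - Complex.I * fderiv ℝ φ (medialPoint δ (medialVertexOf p)) Complex.I) / 2 * ∑ k : Fin 4, bondDartObservable (Λ δ) δ (-5 / 3) (medialCornersAt p.1 p.2 k)) (𝓝[>] 0) (𝓝 0) :=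
  weakHolomorphy_iff_spinShiftVanishes

end Summit.CriticalPhenomena.CardyFormulaZ2.Theorems.WeakHolomorphy.SplitBypass

end
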